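import Summits.AtomisticToContinuum.HydrodynamicLimit.Theses.InformationPercolationEngine

/-!
# Docking-reference gap — finite shadow (negative helper, crux `PercolationClosesChaos`, stmt-AtomisticToContinuum-15178)

Refuter material for the rev-12 line `Sketch` (card ergodic-window-is-von-neumann, `Cruxes/PercolationClosesChaos/Lines/Sketch.lean`
14:08Z) — `Cruxes/PercolationClosesChaos/Disproof.lean` §12, finding F18 (e).

The route target `ContactChaos` reads its `r`-ball pair fields through the TIME MOLLIFIER `bt a = r⁻¹ (1 − |a|/r)₊` centred at the
collision time (`Pm`): it compares a collision at time `s` with the ball's pair law averaged over `[s − r, s + r]`. The typed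
docking conjunct `NoMesoscopicOscillation` of the line compares the kinetic cell with the INSTANTANEOUS ball field at the window
start. At a time where the ball's pair law jumps (a shock crossing the ball: width `≍ ℓ_N ≪ r`, crossing time `≍ r`) the two
references differ by half the jump AT EVERY RESOLUTION `r` — the shadow below: a unit step read through `bt` is worth `1/2`
at the jump, the instantaneous reading is `1`. Hence `stub_kineticDocking` consumes, silently, time-regularity over `±r` of the
evolved `r`-ball pair fields (free for continuous macroscopic limits, paid only in measure near shocks, local-equilibrium class
in general); the honest place for it is the crux-class conjunct itself (corrected signature posted on the item,
`stubs/NoMesoscopicOscillation.md`). No statement of the route is asserted.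
-/

noncomputable section

open MeasureTheory Real intervalIntegral Set

namespace Summit.AtomisticToContinuum.HydrodynamicLimit.Theorems.PercolationClosesChaos.Negative

/-- **Docking-reference gap, finite shadow.** Read through the target's time mollifier `bt a = r⁻¹ · (1 − |a|/r)₊`
(literally `ContactChaos`'s `bt`), a unit step at the reading time is worth `1/2`, for EVERY width `r > 0` — while the
instantaneous reading (the typed `NoMesoscopicOscillation`) is `1`. [folklore] -/
theorem integral_timeHat_mul_heaviside {r : ℝ} (hr : 0 < r) :
    ∫ s in Set.Icc (-r) r, r⁻¹ * max (1 - |s| / r) 0 * (if 0 ≤ s then (1 : ℝ) else 0) = 1 / 2 := by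
  have hcongr : Set.EqOn (fun s => r⁻¹ * max (1 - |s| / r) 0 * (if 0 ≤ s then (1 : ℝ) else 0))
      (Set.indicator (Set.Ici 0) (fun s => r⁻¹ * (1 - s / r))) (Set.Icc (-r) r) := by
    intro s hs
    by_cases h0 : 0 ≤ s
    · have h1 : 0 ≤ 1 - s / r := by
        rw [sub_nonneg, div_le_one hr]; exact hs.2
      simp only [h0, if_true, mul_one, abs_of_nonneg h0, max_eq_left h1,
        Set.indicator_of_mem (show s ∈ Set.Ici (0 : ℝ) from h0)]
    · simp only [h0, if_false, mul_zero, Set.indicator_of_notMem (show s ∉ Set.Ici (0 : ℝ) from h0)]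
  rw [setIntegral_congr_fun measurableSet_Icc hcongr, setIntegral_indicator measurableSet_Ici]
  have hset : Set.Icc (-r) r ∩ Set.Ici 0 = Set.Icc 0 r := by
    ext s
    simp only [Set.mem_inter_iff, Set.mem_Icc, Set.mem_Ici]
    constructor
    · rintro ⟨⟨-, h2⟩, h3⟩; exact ⟨h3, h2⟩
    · rintro ⟨h1, h2⟩; exact ⟨⟨by linarith, h2⟩, h1⟩
  rw [hset, integral_Icc_eq_integral_Ioc, ← intervalIntegral.integral_of_le hr.le,
    intervalIntegral.integral_const_mul]
  have hsub : ∫ x : ℝ in (0 : ℝ)..r, (1 - x / r) = r / 2 := by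
    rw [intervalIntegral.integral_sub, intervalIntegral.integral_const, intervalIntegral.integral_div,
      integral_id]
    · simp only [sub_zero, smul_eq_mul, mul_one]
      field_simp
      ring
    · exact intervalIntegrable_const
    · exact (continuous_id.div_const r).intervalIntegrable 0 r
  rw [hsub]
  field_simp

/-- The instantaneous reading of the same step at the same time is `1`; the gap is exactly half the jump, independent of
`r` — it does not close as `r → 0` (it is paid only in space-time measure). [folklore] -/
theorem docking_reference_gap {r : ℝ} (hr : 0 < r) :
    (if (0 : ℝ) ≤ 0 then (1 : ℝ) else 0) -
        ∫ s in Set.Icc (-r) r, r⁻¹ * max (1 - |s| / r) 0 * (if 0 ≤ s then (1 : ℝ) else 0) = 1 / 2 := by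
  rw [integral_timeHat_mul_heaviside hr]
  norm_num

end Summit.AtomisticToContinuum.HydrodynamicLimit.Theorems.PercolationClosesChaos.Negative

end
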